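import Mathlib
import HarnessLib

/-!
# Toolkit for the tower export glue (route `BalabanTowerExport`, item stmt-QuantumFields-27385)

Three abstract lemmas used by `Theorems/BalabanTowerExportTowerExportGlue.lean`
(`TowerDecoupling → CondResponse → BalabanFamilyExport.FamilyCeilings`):

* `abs_integral_prod_sum_le` — RESUMMATION OVER LEVEL ASSIGNMENTS: if every level assignment
  `σ : Fin n → {0,…,N-1}` has `|∫ ∏ᵢ D i (σ i) dμ| ≤ ∏ᵢ w (σ i)`, then
  `|∫ ∏ᵢ (Σ_{a<N} D i a) dμ| ≤ (Σ_{a<N} w a)ⁿ` (`Finset.prod_univ_sum` twice);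
* `levelWeights_sum_le` — SUMMABLE LEVEL WEIGHTS: with sizes `A/L^{4a}` and the deep-regime decoupling
  factor `C₁ (L^{a+1}/L^k)^{4+δ}` at the levels `a ≤ k-2`, the level weights sum to at most
  `A·L⁴·(2 + C₁ ρ/(1-ρ))/L^{4k}`, `ρ = L^{-δ}` (a geometric series; the two top levels cost `2·A·L⁴/L^{4k}`);
* `ae_eq_zero_of_integral_mul_self_div` — a bounded measurable `f` with `∫ f·(f/D) dμ = 0` vanishes a.e.
  (used for the level-0 identification `p = E[p | Q₀]` a.e.).

Pure measure theory / real analysis; nothing about Yang–Mills is proved here (YM mass gap NOT proved).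
-/

set_option autoImplicit false

namespace Summit.QuantumFields.YangMills.Theorems.BalabanTowerExport.Toolkit

open MeasureTheory

/-- **Resummation over level assignments.**  On a finite measure space let `D i a` (`i : Fin n`, `a : ℕ`)
be bounded measurable functions and `w : ℕ → ℝ` level weights such that every level assignment
`σ : Fin n → ℕ` with `σ i < N` satisfies `|∫ ∏ᵢ D i (σ i) dμ| ≤ ∏ᵢ w (σ i)`.  Then
`|∫ ∏ᵢ (Σ_{a<N} D i a) dμ| ≤ (Σ_{a<N} w a)ⁿ`. -/
theorem abs_integral_prod_sum_le {Ω : Type*} [MeasurableSpace Ω] (μ : Measure Ω) [IsFiniteMeasure μ]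
    {n : ℕ} (N : ℕ) (D : Fin n → ℕ → Ω → ℝ) (w : ℕ → ℝ)
    (hDm : ∀ i a, Measurable (D i a)) (hDb : ∀ i a, ∃ B : ℝ, ∀ ω, |D i a ω| ≤ B)
    (hT : ∀ σ : Fin n → ℕ, (∀ i, σ i < N) → |∫ ω, ∏ i, D i (σ i) ω ∂μ| ≤ ∏ i, w (σ i)) :
    |∫ ω, ∏ i, (∑ a ∈ Finset.range N, D i a ω) ∂μ| ≤ (∑ a ∈ Finset.range N, w a) ^ n := by
  classical
  choose B hB using hDb
  have hPi : ∀ σ : Fin n → ℕ, Integrable (fun ω => ∏ i, D i (σ i) ω) μ := by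
    intro σ
    refine Integrable.mono' (integrable_const (∏ i, B i (σ i)))
      (Finset.measurable_prod _ fun i _ => hDm i (σ i)).aestronglyMeasurable
      (Filter.Eventually.of_forall fun ω => ?_)
    rw [Real.norm_eq_abs, Finset.abs_prod]
    exact Finset.prod_le_prod (fun i _ => abs_nonneg _) fun i _ => hB i (σ i) ω
  have hexp : (fun ω => ∏ i, (∑ a ∈ Finset.range N, D i a ω)) =
      fun ω => ∑ σ ∈ Fintype.piFinset (fun _ : Fin n => Finset.range N), ∏ i, D i (σ i) ω := by
    funext ω
    exact Finset.prod_univ_sum (fun _ => Finset.range N) (fun i a => D i a ω)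
  rw [hexp, integral_finsetSum _ (fun σ _ => hPi σ)]
  calc |∑ σ ∈ Fintype.piFinset (fun _ : Fin n => Finset.range N), ∫ ω, ∏ i, D i (σ i) ω ∂μ|
      ≤ ∑ σ ∈ Fintype.piFinset (fun _ : Fin n => Finset.range N), |∫ ω, ∏ i, D i (σ i) ω ∂μ| :=
        Finset.abs_sum_le_sum_abs _ _
    _ ≤ ∑ σ ∈ Fintype.piFinset (fun _ : Fin n => Finset.range N), ∏ i, w (σ i) :=
        Finset.sum_le_sum fun σ hσ => hT σ fun i => Finset.mem_range.1 (Fintype.mem_piFinset.1 hσ i)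
    _ = ∏ _i : Fin n, ∑ a ∈ Finset.range N, w a :=
        (Finset.prod_univ_sum (fun _ : Fin n => Finset.range N) (fun _ a => w a)).symm
    _ = (∑ a ∈ Finset.range N, w a) ^ n := by
        rw [Finset.prod_const, Finset.card_univ, Fintype.card_fin]

/-- **Summable level weights.**  For `L > 1`, `C₁, A ≥ 0`, `δ > 0` and every depth `k`, the level weights
`w a = C₁ (L^{a+1}/L^k)^{4+δ} · A/L^{4a}` for the deep levels `a + 2 ≤ k` and `w a = A/L^{4a}` for the two top
levels `a ∈ {k-1, k}` sum over `a ≤ k` to at most `A L⁴ (2 + C₁ ρ/(1-ρ)) / L^{4k}` with `ρ = (L⁻¹)^δ`: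
the deep levels form the geometric series `C₁ A L⁴ L^{-4k} Σ_{t ≥ 1} ρᵗ`. -/
theorem levelWeights_sum_le {L C₁ A δ : ℝ} (hL : 1 < L) (hC₁ : 0 ≤ C₁) (hA : 0 ≤ A) (hδ : 0 < δ)
    (k : ℕ) :
    ∑ a ∈ Finset.range (k + 1),
        (if a + 2 ≤ k then C₁ * (L ^ (a + 1) / L ^ k) ^ (4 + δ) * (A / (L ^ a) ^ 4)
          else A / (L ^ a) ^ 4)
      ≤ A * L ^ 4 * (2 + C₁ * (L⁻¹ ^ δ / (1 - L⁻¹ ^ δ))) / (L ^ k) ^ 4 := by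
  have hL0 : 0 < L := lt_trans zero_lt_one hL
  have hLi0 : 0 ≤ L⁻¹ := inv_nonneg.2 hL0.le
  have hLi1 : L⁻¹ < 1 := inv_lt_one_of_one_lt₀ hL
  set ρ : ℝ := L⁻¹ ^ δ with hρ
  have hρ0 : 0 ≤ ρ := Real.rpow_nonneg hLi0 δ
  have hρ1 : ρ < 1 := Real.rpow_lt_one hLi0 hLi1 hδ
  have hLk : 0 < (L ^ k) ^ 4 := by positivity
  set M : ℝ := A * L ^ 4 / (L ^ k) ^ 4 with hM
  have hM0 : 0 ≤ M := by positivity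
  rw [Finset.sum_ite]
  -- the deep levels `a + 2 ≤ k`, i.e. `a < k - 1`
  have hfilt : (Finset.range (k + 1)).filter (fun a => a + 2 ≤ k) = Finset.range (k - 1) := by
    ext a
    simp only [Finset.mem_filter, Finset.mem_range]
    omega
  have hdeep : ∀ a : ℕ, a + 2 ≤ k →
      C₁ * (L ^ (a + 1) / L ^ k) ^ (4 + δ) * (A / (L ^ a) ^ 4) = C₁ * M * ρ ^ (k - 1 - a) := by
    intro a ha
    have hx : L ^ (a + 1) / L ^ k = L⁻¹ ^ (k - 1 - a) := by
      have hk : L ^ k = L ^ (a + 1) * L ^ (k - 1 - a) := by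
        rw [← pow_add]; congr 1; omega
      rw [hk, inv_pow, div_mul_eq_div_div, div_self (by positivity), one_div]
    have hx0 : 0 < L ^ (a + 1) / L ^ k := by positivity
    have h4 : (L ^ (a + 1) / L ^ k) ^ (4 + δ) = (L ^ (a + 1) / L ^ k) ^ (4 : ℕ) * ρ ^ (k - 1 - a) := by
      rw [Real.rpow_add hx0, Real.rpow_ofNat, hx, hρ, ← Real.rpow_natCast_mul hLi0,
        mul_comm ((k - 1 - a : ℕ) : ℝ) δ, Real.rpow_mul_natCast hLi0]
    rw [h4, hM]
    field_simp
    ring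
  have hsum1 : ∑ a ∈ (Finset.range (k + 1)).filter (fun a => a + 2 ≤ k),
      C₁ * (L ^ (a + 1) / L ^ k) ^ (4 + δ) * (A / (L ^ a) ^ 4) ≤ C₁ * M * (ρ / (1 - ρ)) := by
    rw [hfilt]
    have h1 : ∑ a ∈ Finset.range (k - 1), C₁ * (L ^ (a + 1) / L ^ k) ^ (4 + δ) * (A / (L ^ a) ^ 4) =
        ∑ a ∈ Finset.range (k - 1), C₁ * M * ρ ^ (k - 1 - a) :=
      Finset.sum_congr rfl fun a ha => hdeep a (by have := Finset.mem_range.1 ha; omega)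
    have h2 : ∑ a ∈ Finset.range (k - 1), C₁ * M * ρ ^ (k - 1 - a) =
        C₁ * M * (ρ * ∑ j ∈ Finset.range (k - 1), ρ ^ j) := by
      rw [← Finset.mul_sum, Finset.mul_sum (s := Finset.range (k - 1)) (f := fun j => ρ ^ j) ρ,
        ← Finset.sum_range_reflect (fun j => ρ * ρ ^ j) (k - 1)]
      congr 1
      refine Finset.sum_congr rfl fun a ha => ?_
      have ha' := Finset.mem_range.1 ha
      rw [← pow_succ']
      congr 1
      omega
    rw [h1, h2]
    refine mul_le_mul_of_nonneg_left ?_ (mul_nonneg hC₁ hM0)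
    rw [div_eq_mul_inv]
    refine mul_le_mul_of_nonneg_left ?_ hρ0
    exact sum_le_hasSum _ (fun j _ => pow_nonneg hρ0 j) (hasSum_geometric_of_lt_one hρ0 hρ1)
  -- the two top levels `a ∈ {k - 1, k}`
  have hsum2 : ∑ a ∈ (Finset.range (k + 1)).filter (fun a => ¬ (a + 2 ≤ k)), A / (L ^ a) ^ 4 ≤ 2 * M := by
    have hcard : ((Finset.range (k + 1)).filter (fun a => ¬ (a + 2 ≤ k))).card ≤ 2 := by
      have hsub : (Finset.range (k + 1)).filter (fun a => ¬ (a + 2 ≤ k)) ⊆ {k - 1, k} := by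
        intro a ha
        simp only [Finset.mem_filter, Finset.mem_range] at ha
        simp only [Finset.mem_insert, Finset.mem_singleton]
        omega
      exact (Finset.card_le_card hsub).trans (Finset.card_le_two)
    have hterm : ∀ a ∈ (Finset.range (k + 1)).filter (fun a => ¬ (a + 2 ≤ k)), A / (L ^ a) ^ 4 ≤ M := by
      intro a ha
      simp only [Finset.mem_filter, Finset.mem_range] at ha
      rw [hM, mul_div_assoc]
      rw [show A / (L ^ a) ^ 4 = A * (1 / (L ^ a) ^ 4) by ring]
      refine mul_le_mul_of_nonneg_left ?_ hA
      rw [div_le_div_iff₀ (by positivity) hLk, one_mul, ← mul_pow, ← pow_succ']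
      exact pow_le_pow_left₀ (by positivity) (pow_le_pow_right₀ hL.le (by omega)) 4
    calc ∑ a ∈ (Finset.range (k + 1)).filter (fun a => ¬ (a + 2 ≤ k)), A / (L ^ a) ^ 4
        ≤ ((Finset.range (k + 1)).filter (fun a => ¬ (a + 2 ≤ k))).card • M :=
          Finset.sum_le_card_nsmul _ _ _ hterm
      _ ≤ (2 : ℕ) • M := by
          rw [nsmul_eq_mul, nsmul_eq_mul]
          exact mul_le_mul_of_nonneg_right (by exact_mod_cast hcard) hM0
      _ = 2 * M := by rw [nsmul_eq_mul]; norm_num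
  calc _ ≤ C₁ * M * (ρ / (1 - ρ)) + 2 * M := add_le_add hsum1 hsum2
    _ = A * L ^ 4 * (2 + C₁ * (ρ / (1 - ρ))) / (L ^ k) ^ 4 := by rw [hM]; ring

/-- **A bounded measurable function orthogonal to itself vanishes a.e.**  On a finite measure space, if
`f` is measurable, `|f| ≤ B`, `D > 0` and `∫ f · (f / D) dμ = 0`, then `f = 0` a.e. -/
theorem ae_eq_zero_of_integral_mul_self_div {Ω : Type*} [MeasurableSpace Ω] (μ : Measure Ω)
    [IsFiniteMeasure μ] (f : Ω → ℝ) (hfm : Measurable f) {B D : ℝ} (hfb : ∀ ω, |f ω| ≤ B) (hD : 0 < D)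
    (horth : ∫ ω, f ω * (f ω / D) ∂μ = 0) : f =ᵐ[μ] 0 := by
  have hff : Integrable (fun ω => f ω * f ω) μ := by
    refine Integrable.mono' (integrable_const (B * B)) (hfm.mul hfm).aestronglyMeasurable
      (Filter.Eventually.of_forall fun ω => ?_)
    rw [Real.norm_eq_abs, abs_mul]
    exact mul_le_mul (hfb ω) (hfb ω) (abs_nonneg _) ((abs_nonneg _).trans (hfb ω))
  have h1 : ∫ ω, f ω * f ω ∂μ = 0 := by
    have h2 : ∫ ω, f ω * (f ω / D) ∂μ = (∫ ω, f ω * f ω ∂μ) / D := by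
      rw [← integral_div]
      refine integral_congr_ae (Filter.Eventually.of_forall fun ω => ?_)
      ring
    rw [h2, div_eq_zero_iff] at horth
    exact horth.resolve_right hD.ne'
  have h3 : (fun ω => f ω * f ω) =ᵐ[μ] 0 :=
    (integral_eq_zero_iff_of_nonneg (fun ω => mul_self_nonneg (f ω)) hff).1 h1
  filter_upwards [h3] with ω hω
  exact mul_self_eq_zero.1 hω

end Summit.QuantumFields.YangMills.Theorems.BalabanTowerExport.Toolkit
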